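import Summits.QuantumFields.YangMills.Theorems.FlatTubeReductionFPLevelSetVolume
import Summits.QuantumFields.YangMills.Theorems.LuscherReductionTwistedTraceScalingBTDiagonalIntegral
import HarnessLib

/-!
# The `F`-weighted volume of the kinetic level set on the full fibre/gauge product, `F = Ω(v̂)·fpWeight ε(g)·Ω(v̂′)`: Fubini of `…FPLevelSetVolume` against the profile —
# `∫_{kinDefect ≤ D} F dμP ≤ fpZ ε·∫∫ Ω(v̂)Ω(v̂′)·((π²/12)(3L(√D + 5√2‖v̂‖ + √2‖v̂′‖))³)^{|Λ|−1} dπ dπ` (profile moments appear, nothing else)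
# (route `FlatTubeReduction`, crux K1 `NearFlatRatioLaw` stmt-QuantumFields-24720; seat `ym-line-ftr-p1` g12; rate twin «ratepack-v3 / frozen fibres»; R2b1 RECORD rung — no summit
# statement is proved here)

WHY (memo `Cruxes/NearFlatRatioLaw/Lines/ratepack-v3-frozen-g12.md` §§5.7–5.8, brick (viii-c)).  This is the volume-growth hypothesis `hV` of `…GaussianLayerCakeWeighted.moment_ratio_le_weighted`
/ `setIntegral_weighted_tail_le` for the reference density of the (T)-diagonal, at level `D = t/β` of `N = β·kinDefect(oT 1 v, oT 1 v′, g)`: the gauge integral is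
`…FPLevelSetVolume.integral_fpWeight_kinLevelSet_le` with the link amplitudes `a = √2‖v̂‖`, `a′ = √2‖v̂′‖` of the vacuum tube pair (lane A's `norm_su2Quat_orthoTube_sub_one_le`),
and the two fibre integrals are left as PROFILE MOMENTS (the profile support hypothesis is lane A's `hΩt`).
  ★★ `setIntegral_profile_kinLevelSet_le`.
HONEST FRAMING: Fubini bookkeeping; femto rung R2b1 (RECORD label); not infinite volume, not a gap, not Clay.  No defs, no named facts, no `sorry`.
-/

set_option autoImplicit false

noncomputable section

open MeasureTheory Filter Topology Real Set
open scoped BigOperators ENNReal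
open Literature.MathematicalPhysics.QuantumFieldTheory
open Literature.MathematicalPhysics.QuantumLattice

namespace Summit.QuantumFields.YangMills.Theorems.FemtoTransferGap.RateTube

open Summit.QuantumFields.YangMills.Theorems.FemtoTransferGap
open Summit.QuantumFields.YangMills.Theorems.FemtoTransferGap.TwoLattice
open Summit.QuantumFields.YangMills.Theorems.FemtoTransferGap.TwoLattice.ConstTube
open Summit.QuantumFields.YangMills.Theorems.FemtoTransferGap.TwoLattice.Avg
open Summit.QuantumFields.YangMills.Theorems.FemtoTransferGap.TwoLattice.Stiff (LinkSpace)

variable {L : ℕ} [NeZero L]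

/-- The kinetic defect is jointly continuous in `(U, V, g)`. [folklore] -/
theorem continuous_kinDefect_joint : Continuous fun q : GaugeConfig 3 L SU2 × (GaugeConfig 3 L SU2 × (Site 3 L → SU2)) => kinDefect L q.1 q.2.1 q.2.2 := by
  have hq := Literature.MathematicalPhysics.QuantumFieldTheory.Balaban1983to89.T4HaarSU2Translate.continuous_su2Quat
  unfold kinDefect
  refine continuous_finsetSum _ fun e _ => ?_
  have hU : Continuous fun q : GaugeConfig 3 L SU2 × (GaugeConfig 3 L SU2 × (Site 3 L → SU2)) => su2Quat (q.1 e) := hq.comp ((continuous_apply e).comp continuous_fst)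
  have hV : Continuous fun q : GaugeConfig 3 L SU2 × (GaugeConfig 3 L SU2 × (Site 3 L → SU2)) => su2Quat (q.2.1 e) :=
    hq.comp ((continuous_apply e).comp (continuous_fst.comp continuous_snd))
  have hgy : Continuous fun q : GaugeConfig 3 L SU2 × (GaugeConfig 3 L SU2 × (Site 3 L → SU2)) => su2Quat (q.2.2 (e.1.shift e.2)) :=
    hq.comp ((continuous_apply (e.1.shift e.2)).comp (continuous_snd.comp continuous_snd))
  have hgx : Continuous fun q : GaugeConfig 3 L SU2 × (GaugeConfig 3 L SU2 × (Site 3 L → SU2)) => su2Quat (q.2.2 e.1) :=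
    hq.comp ((continuous_apply e.1).comp (continuous_snd.comp continuous_snd))
  exact ((hU.mul hgy).sub (hgx.mul hV)).norm.pow 2

/-- The level set of the vacuum tube pair is measurable in `p = (v, v′, g)`. [folklore] -/
theorem measurableSet_tubeKinLevelSet (D : ℝ) :
    MeasurableSet {p : (Edge 3 L → Fin 3 → ℝ) × ((Edge 3 L → Fin 3 → ℝ) × (Site 3 L → SU2)) | kinDefect L (orthoTube L 1 p.1) (orthoTube L 1 p.2.1) p.2.2 ≤ D} := by
  have h1 : Measurable fun p : (Edge 3 L → Fin 3 → ℝ) × ((Edge 3 L → Fin 3 → ℝ) × (Site 3 L → SU2)) => orthoTube L 1 p.1 := (measurable_orthoTube_right (L := L) 1).comp measurable_fst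
  have h2 : Measurable fun p : (Edge 3 L → Fin 3 → ℝ) × ((Edge 3 L → Fin 3 → ℝ) × (Site 3 L → SU2)) => orthoTube L 1 p.2.1 :=
    (measurable_orthoTube_right (L := L) 1).comp (measurable_fst.comp measurable_snd)
  have h3 : Measurable fun p : (Edge 3 L → Fin 3 → ℝ) × ((Edge 3 L → Fin 3 → ℝ) × (Site 3 L → SU2)) => p.2.2 := measurable_snd.comp measurable_snd
  have h := continuous_kinDefect_joint (L := L) |>.measurable.comp (h1.prodMk (h2.prodMk h3))
  exact measurableSet_le h measurable_const

set_option maxHeartbeats 400000 in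
/-- ★★ **Volume growth of the reference weight.**  `Ω ≥ 0` bounded measurable with support in the capped balanced set (`Ω(v̂) ≠ 0 ⇒ v ∈ capBalancedSet ∧ ‖v̂‖ ≤ R`), `ε` any:
`∫_{kinDefect(oT 1 v, oT 1 v′, g) ≤ D} Ω(v̂)·fpWeight ε(g)·Ω(v̂′) dμP ≤ fpZ ε·∫_v∫_{v′} Ω(v̂)Ω(v̂′)·((π²/12)(3L(√D + 5√2‖v̂‖ + √2‖v̂′‖))³)^{|Λ|−1} dπdπ`. [cite: Luscher1983, §3] -/
theorem setIntegral_profile_kinLevelSet_le {Ω : LinkSpace L → ℝ} (hΩm : Measurable Ω) {CΩ : ℝ} (hCΩ : ∀ x, |Ω x| ≤ CΩ) (hΩ0 : ∀ x, 0 ≤ Ω x) {R : ℝ}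
    (hΩt : ∀ v : Edge 3 L → Fin 3 → ℝ, Ω (linkEmbed L v) ≠ 0 → v ∈ capBalancedSet L ∧ ‖linkEmbed L v‖ ≤ R) (ε D : ℝ) :
    ∫ p in {p : (Edge 3 L → Fin 3 → ℝ) × ((Edge 3 L → Fin 3 → ℝ) × (Site 3 L → SU2)) | kinDefect L (orthoTube L 1 p.1) (orthoTube L 1 p.2.1) p.2.2 ≤ D},
        Ω (linkEmbed L p.1) * (fpWeight L ε p.2.2 * Ω (linkEmbed L p.2.1)) ∂((orthoTransverse L).prod ((orthoTransverse L).prod (gaugeMeasure L))) ≤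
      fpZ ε * ∫ v, ∫ v', Ω (linkEmbed L v) * Ω (linkEmbed L v') *
        (π ^ 2 / 12 * (3 * L * (Real.sqrt D + 5 * (Real.sqrt 2 * ‖linkEmbed L v‖) + Real.sqrt 2 * ‖linkEmbed L v'‖)) ^ 3) ^ Fintype.card {x : Site 3 L // ¬x = 0}
        ∂orthoTransverse L ∂orthoTransverse L := by
  haveI := isFiniteMeasure_orthoTransverse L
  haveI : SecondCountableTopology SU2 := secondCountableTopology_su2
  set n : ℕ := Fintype.card {x : Site 3 L // ¬x = 0} with hn
  set S : Set ((Edge 3 L → Fin 3 → ℝ) × ((Edge 3 L → Fin 3 → ℝ) × (Site 3 L → SU2))) :=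
    {p | kinDefect L (orthoTube L 1 p.1) (orthoTube L 1 p.2.1) p.2.2 ≤ D} with hS
  have hSm : MeasurableSet S := measurableSet_tubeKinLevelSet (L := L) D
  -- the box function
  obtain ⟨B, hB⟩ : ∃ B : (Edge 3 L → Fin 3 → ℝ) → (Edge 3 L → Fin 3 → ℝ) → ℝ, ∀ v v', B v v' =
      (π ^ 2 / 12 * (3 * L * (Real.sqrt D + 5 * (Real.sqrt 2 * ‖linkEmbed L v‖) + Real.sqrt 2 * ‖linkEmbed L v'‖)) ^ 3) ^ n := ⟨fun v v' => _, fun _ _ => rfl⟩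
  have hB0 : ∀ v v', 0 ≤ B v v' := fun v v' => by rw [hB]; positivity
  have hle : Measurable (linkEmbed L) := measurable_linkEmbed L
  have hfw : Measurable (fpWeight L ε) := measurable_fpWeight L ε
  have hBm : Measurable fun q : (Edge 3 L → Fin 3 → ℝ) × (Edge 3 L → Fin 3 → ℝ) => B q.1 q.2 := by
    have h1 : Measurable fun q : (Edge 3 L → Fin 3 → ℝ) × (Edge 3 L → Fin 3 → ℝ) => ‖linkEmbed L q.1‖ := (hle.comp measurable_fst).norm
    have h2 : Measurable fun q : (Edge 3 L → Fin 3 → ℝ) × (Edge 3 L → Fin 3 → ℝ) => ‖linkEmbed L q.2‖ := (hle.comp measurable_snd).norm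
    have h3 : Measurable fun q : (Edge 3 L → Fin 3 → ℝ) × (Edge 3 L → Fin 3 → ℝ) =>
        (π ^ 2 / 12 * (3 * L * (Real.sqrt D + 5 * (Real.sqrt 2 * ‖linkEmbed L q.1‖) + Real.sqrt 2 * ‖linkEmbed L q.2‖)) ^ 3) ^ n :=
      ((((((h1.const_mul (Real.sqrt 2)).const_mul 5).const_add (Real.sqrt D)).add (h2.const_mul (Real.sqrt 2))).const_mul (3 * (L : ℝ))).pow_const 3
        |>.const_mul (π ^ 2 / 12)).pow_const n
    rw [show (fun q : (Edge 3 L → Fin 3 → ℝ) × (Edge 3 L → Fin 3 → ℝ) => B q.1 q.2) =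
        fun q => (π ^ 2 / 12 * (3 * L * (Real.sqrt D + 5 * (Real.sqrt 2 * ‖linkEmbed L q.1‖) + Real.sqrt 2 * ‖linkEmbed L q.2‖)) ^ 3) ^ n
      from funext fun q => hB q.1 q.2]
    exact h3
  -- the box bound is monotone in the radii, hence bounded on the support by `B(R,R)`-type constant
  set BR : ℝ := (π ^ 2 / 12 * (3 * L * (Real.sqrt D + 5 * (Real.sqrt 2 * |R|) + Real.sqrt 2 * |R|)) ^ 3) ^ n with hBR
  have hBR0 : 0 ≤ BR := by rw [hBR]; positivity
  have hBle : ∀ v v', ‖linkEmbed L v‖ ≤ R → ‖linkEmbed L v'‖ ≤ R → B v v' ≤ BR := fun v v' hv hv' => by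
    rw [hB, hBR]
    have hR : R ≤ |R| := le_abs_self R
    have h1 : ‖linkEmbed L v‖ ≤ |R| := hv.trans hR
    have h2 : ‖linkEmbed L v'‖ ≤ |R| := hv'.trans hR
    have hD0 := Real.sqrt_nonneg D
    have hL0 : (0 : ℝ) ≤ L := Nat.cast_nonneg _
    apply pow_le_pow_left₀ (by positivity)
    apply mul_le_mul_of_nonneg_left _ (by positivity)
    apply pow_le_pow_left₀ (by positivity)
    apply mul_le_mul_of_nonneg_left _ (by positivity)
    nlinarith [Real.sqrt_nonneg 2, mul_le_mul_of_nonneg_left h1 (Real.sqrt_nonneg 2), mul_le_mul_of_nonneg_left h2 (Real.sqrt_nonneg 2)]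
  have hCΩ0 : 0 ≤ CΩ := (abs_nonneg _).trans (hCΩ 0)
  -- the integrand
  set Φ : (Edge 3 L → Fin 3 → ℝ) × ((Edge 3 L → Fin 3 → ℝ) × (Site 3 L → SU2)) → ℝ := fun p => S.indicator (fun p => Ω (linkEmbed L p.1) * (fpWeight L ε p.2.2 * Ω (linkEmbed L p.2.1))) p
    with hΦ
  have hFm : Measurable fun p : (Edge 3 L → Fin 3 → ℝ) × ((Edge 3 L → Fin 3 → ℝ) × (Site 3 L → SU2)) => Ω (linkEmbed L p.1) * (fpWeight L ε p.2.2 * Ω (linkEmbed L p.2.1)) := by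
    have a1 : Measurable fun p : (Edge 3 L → Fin 3 → ℝ) × ((Edge 3 L → Fin 3 → ℝ) × (Site 3 L → SU2)) => Ω (linkEmbed L p.1) := hΩm.comp (hle.comp measurable_fst)
    have a2 : Measurable fun p : (Edge 3 L → Fin 3 → ℝ) × ((Edge 3 L → Fin 3 → ℝ) × (Site 3 L → SU2)) => fpWeight L ε p.2.2 := hfw.comp (measurable_snd.comp measurable_snd)
    have a3 : Measurable fun p : (Edge 3 L → Fin 3 → ℝ) × ((Edge 3 L → Fin 3 → ℝ) × (Site 3 L → SU2)) => Ω (linkEmbed L p.2.1) :=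
      hΩm.comp (hle.comp (measurable_fst.comp measurable_snd))
    exact a1.mul (a2.mul a3)
  have hF0 : ∀ p : (Edge 3 L → Fin 3 → ℝ) × ((Edge 3 L → Fin 3 → ℝ) × (Site 3 L → SU2)), 0 ≤ Ω (linkEmbed L p.1) * (fpWeight L ε p.2.2 * Ω (linkEmbed L p.2.1)) := fun p =>
    mul_nonneg (hΩ0 _) (mul_nonneg (fpWeight_mem_Icc L ε _).1 (hΩ0 _))
  have hFb : ∀ p : (Edge 3 L → Fin 3 → ℝ) × ((Edge 3 L → Fin 3 → ℝ) × (Site 3 L → SU2)), Ω (linkEmbed L p.1) * (fpWeight L ε p.2.2 * Ω (linkEmbed L p.2.1)) ≤ CΩ * CΩ := fun p => by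
    calc Ω (linkEmbed L p.1) * (fpWeight L ε p.2.2 * Ω (linkEmbed L p.2.1)) ≤ CΩ * (1 * CΩ) :=
          mul_le_mul ((le_abs_self _).trans (hCΩ _)) (mul_le_mul (fpWeight_mem_Icc L ε _).2 ((le_abs_self _).trans (hCΩ _)) (hΩ0 _) zero_le_one)
            (mul_nonneg (fpWeight_mem_Icc L ε _).1 (hΩ0 _)) hCΩ0
      _ = CΩ * CΩ := by ring
  have hΦm : Measurable Φ := hFm.indicator hSm
  have hΦ0 : ∀ p, 0 ≤ Φ p := fun p => Set.indicator_nonneg (fun q _ => hF0 q) _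
  have hΦb : ∀ p, |Φ p| ≤ CΩ * CΩ := fun p => by
    rw [abs_of_nonneg (hΦ0 p), hΦ]
    exact (Set.indicator_le_self' (fun q _ => hF0 q) p).trans (hFb p)
  set μP := (orthoTransverse L).prod ((orthoTransverse L).prod (gaugeMeasure L)) with hμP
  have hΦi : Integrable Φ μP := integrable_of_measurable_abs_le _ hΦm hΦb
  rw [← integral_indicator hSm]
  change ∫ p, Φ p ∂μP ≤ _
  rw [hμP, integral_prod _ (by rw [hμP] at hΦi; exact hΦi)]
  -- the inner (v′, g)-integral at fixed v
  have hsec : ∀ v : Edge 3 L → Fin 3 → ℝ, Integrable (fun q : (Edge 3 L → Fin 3 → ℝ) × (Site 3 L → SU2) => Φ (v, q)) ((orthoTransverse L).prod (gaugeMeasure L)) := fun v =>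
    integrable_of_measurable_abs_le _ (hΦm.comp measurable_prodMk_left) fun q => hΦb (v, q)
  have hinner_g : ∀ (v v' : Edge 3 L → Fin 3 → ℝ), ∫ g, Φ (v, (v', g)) ∂gaugeMeasure L ≤ Ω (linkEmbed L v) * Ω (linkEmbed L v') * (fpZ ε * B v v') := by
    intro v v'
    have e : ∀ g, Φ (v, (v', g)) = Ω (linkEmbed L v) * Ω (linkEmbed L v') *
        (fpWeight L ε g * Set.indicator {g : Site 3 L → SU2 | kinDefect L (orthoTube L 1 v) (orthoTube L 1 v') g ≤ D} (fun _ => (1 : ℝ)) g) := fun g => by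
      simp only [hΦ, hS, Set.indicator_apply, Set.mem_setOf_eq]
      split_ifs <;> ring
    rw [integral_congr_ae (ae_of_all _ e), integral_const_mul]
    have hΩΩ0 : 0 ≤ Ω (linkEmbed L v) * Ω (linkEmbed L v') := mul_nonneg (hΩ0 _) (hΩ0 _)
    by_cases hz : Ω (linkEmbed L v) * Ω (linkEmbed L v') = 0
    · rw [hz, zero_mul, zero_mul]
    · have hv : Ω (linkEmbed L v) ≠ 0 := fun h => hz (by rw [h, zero_mul])
      have hv' : Ω (linkEmbed L v') ≠ 0 := fun h => hz (by rw [h, mul_zero])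
      have hvc := (hΩt v hv).1
      have hv'c := (hΩt v' hv').1
      have hv1 : ∀ e : Edge 3 L, ∑ a, v e a ^ 2 ≤ 1 := sum_sq_le_one_of_cap L hvc.2
      have hv'1 : ∀ e : Edge 3 L, ∑ a, v' e a ^ 2 ≤ 1 := sum_sq_le_one_of_cap L hv'c.2
      have ha : ∀ e, ‖su2Quat (orthoTube L 1 v e) - 1‖ ≤ Real.sqrt 2 * ‖linkEmbed L v‖ := fun e => by
        have h := norm_su2Quat_orthoTube_sub_one_le (1 : GaugeConfig 3 1 SU2) hv1 e
        rw [Pi.one_apply, su2Quat_one, sub_self, norm_zero, add_zero] at h; exact h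
      have ha' : ∀ e, ‖su2Quat (orthoTube L 1 v' e) - 1‖ ≤ Real.sqrt 2 * ‖linkEmbed L v'‖ := fun e => by
        have h := norm_su2Quat_orthoTube_sub_one_le (1 : GaugeConfig 3 1 SU2) hv'1 e
        rw [Pi.one_apply, su2Quat_one, sub_self, norm_zero, add_zero] at h; exact h
      have h := integral_fpWeight_kinLevelSet_le (L := L) ε (orthoTube L 1 v) (orthoTube L 1 v') ha ha' D
      exact mul_le_mul_of_nonneg_left (by rw [hB]; exact h) hΩΩ0
  -- integrate in v′ then in v
  have hstep : ∀ v : Edge 3 L → Fin 3 → ℝ, ∫ q, Φ (v, q) ∂(orthoTransverse L).prod (gaugeMeasure L) ≤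
      ∫ v', Ω (linkEmbed L v) * Ω (linkEmbed L v') * (fpZ ε * B v v') ∂orthoTransverse L := by
    intro v
    rw [integral_prod _ (hsec v)]
    have hI1 : Integrable (fun v' => ∫ g, Φ (v, (v', g)) ∂gaugeMeasure L) (orthoTransverse L) := (hsec v).integral_prod_left
    have hI2 : Integrable (fun v' => Ω (linkEmbed L v) * Ω (linkEmbed L v') * (fpZ ε * B v v')) (orthoTransverse L) := by
      have b1 : Measurable fun v' : Edge 3 L → Fin 3 → ℝ => Ω (linkEmbed L v') := hΩm.comp hle
      have b2 : Measurable fun v' : Edge 3 L → Fin 3 → ℝ => B v v' := hBm.comp (measurable_const.prodMk measurable_id)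
      have hm : Measurable fun v' => Ω (linkEmbed L v) * Ω (linkEmbed L v') * (fpZ ε * B v v') := (b1.const_mul _).mul (b2.const_mul _)
      refine integrable_of_measurable_abs_le _ hm (C := CΩ * CΩ * (|fpZ ε| * BR)) fun v' => ?_
      by_cases hz : Ω (linkEmbed L v) * Ω (linkEmbed L v') = 0
      · rw [hz, zero_mul, abs_zero]; exact mul_nonneg (mul_nonneg hCΩ0 hCΩ0) (mul_nonneg (abs_nonneg _) hBR0)
      · have hv : Ω (linkEmbed L v) ≠ 0 := fun h => hz (by rw [h, zero_mul])
        have hv' : Ω (linkEmbed L v') ≠ 0 := fun h => hz (by rw [h, mul_zero])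
        rw [abs_mul, abs_mul, abs_mul, abs_of_nonneg (hB0 v v')]
        exact mul_le_mul (mul_le_mul (hCΩ _) (hCΩ _) (abs_nonneg _) hCΩ0) (mul_le_mul_of_nonneg_left (hBle v v' (hΩt v hv).2 (hΩt v' hv').2) (abs_nonneg _))
          (mul_nonneg (abs_nonneg _) (hB0 v v')) (mul_nonneg hCΩ0 hCΩ0)
    exact integral_mono hI1 hI2 fun v' => hinner_g v v'
  have hJ1 : Integrable (fun v => ∫ q, Φ (v, q) ∂(orthoTransverse L).prod (gaugeMeasure L)) (orthoTransverse L) := by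
    have h := (show Integrable Φ ((orthoTransverse L).prod ((orthoTransverse L).prod (gaugeMeasure L))) by rw [hμP] at hΦi; exact hΦi).integral_prod_left
    exact h
  have hJ2 : Integrable (fun v => ∫ v', Ω (linkEmbed L v) * Ω (linkEmbed L v') * (fpZ ε * B v v') ∂orthoTransverse L) (orthoTransverse L) := by
    have hG : Integrable (fun q : (Edge 3 L → Fin 3 → ℝ) × (Edge 3 L → Fin 3 → ℝ) => Ω (linkEmbed L q.1) * Ω (linkEmbed L q.2) * (fpZ ε * B q.1 q.2))
        ((orthoTransverse L).prod (orthoTransverse L)) := by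
      have c1 : Measurable fun q : (Edge 3 L → Fin 3 → ℝ) × (Edge 3 L → Fin 3 → ℝ) => Ω (linkEmbed L q.1) := hΩm.comp (hle.comp measurable_fst)
      have c2 : Measurable fun q : (Edge 3 L → Fin 3 → ℝ) × (Edge 3 L → Fin 3 → ℝ) => Ω (linkEmbed L q.2) := hΩm.comp (hle.comp measurable_snd)
      have hm : Measurable fun q : (Edge 3 L → Fin 3 → ℝ) × (Edge 3 L → Fin 3 → ℝ) => Ω (linkEmbed L q.1) * Ω (linkEmbed L q.2) * (fpZ ε * B q.1 q.2) :=
        (c1.mul c2).mul (hBm.const_mul _)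
      refine integrable_of_measurable_abs_le _ hm (C := CΩ * CΩ * (|fpZ ε| * BR)) fun q => ?_
      by_cases hz : Ω (linkEmbed L q.1) * Ω (linkEmbed L q.2) = 0
      · rw [hz, zero_mul, abs_zero]; exact mul_nonneg (mul_nonneg hCΩ0 hCΩ0) (mul_nonneg (abs_nonneg _) hBR0)
      · have hv : Ω (linkEmbed L q.1) ≠ 0 := fun h => hz (by rw [h, zero_mul])
        have hv' : Ω (linkEmbed L q.2) ≠ 0 := fun h => hz (by rw [h, mul_zero])
        rw [abs_mul, abs_mul, abs_mul, abs_of_nonneg (hB0 q.1 q.2)]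
        exact mul_le_mul (mul_le_mul (hCΩ _) (hCΩ _) (abs_nonneg _) hCΩ0) (mul_le_mul_of_nonneg_left (hBle q.1 q.2 (hΩt q.1 hv).2 (hΩt q.2 hv').2) (abs_nonneg _))
          (mul_nonneg (abs_nonneg _) (hB0 q.1 q.2)) (mul_nonneg hCΩ0 hCΩ0)
    exact hG.integral_prod_left
  calc ∫ v, ∫ q, Φ (v, q) ∂(orthoTransverse L).prod (gaugeMeasure L) ∂orthoTransverse L
      ≤ ∫ v, ∫ v', Ω (linkEmbed L v) * Ω (linkEmbed L v') * (fpZ ε * B v v') ∂orthoTransverse L ∂orthoTransverse L := integral_mono hJ1 hJ2 hstep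
    _ = fpZ ε * ∫ v, ∫ v', Ω (linkEmbed L v) * Ω (linkEmbed L v') *
        (π ^ 2 / 12 * (3 * L * (Real.sqrt D + 5 * (Real.sqrt 2 * ‖linkEmbed L v‖) + Real.sqrt 2 * ‖linkEmbed L v'‖)) ^ 3) ^ n
          ∂orthoTransverse L ∂orthoTransverse L := by
        rw [← integral_const_mul]
        refine integral_congr_ae (ae_of_all _ fun v => ?_)
        dsimp only
        rw [← integral_const_mul]
        refine integral_congr_ae (ae_of_all _ fun v' => ?_)
        dsimp only
        rw [hB]; ring

end Summit.QuantumFields.YangMills.Theorems.FemtoTransferGap.RateTube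

end
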